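import Literature.MathematicalPhysics.QuantumFieldTheory.Balaban1983to89.B2Ineq347SeqCount

/-!
# `Balaban1983to89.B2Ineq347SumToSup` — [Balaban1982Higgs2] Sect. 3.C p. 593, the UNPRINTED step (3.46) ⇒ (3.47)
# *"After easy transformations we get"*, part 2/3: the per-sequence bound and the leaf `B2Sect3C.Leaf347` ((3.47))
# DERIVED from the (3.46) shape, the sequence count of part 1 and the STATED termwise collar absorption

statement-level skeleton of published theorems with citation tags; proofs where landed; nothing here is a claim about the Yang–Mills mass gap

PDF held: `paper:balaban1982-cmp86-higgs23-ii` (T. Bałaban, *(Higgs)₂,₃ quantum fields in a finite volume. II. An upper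
bound*, Commun. Math. Phys. **86** (1982) 555–594 [Balaban1982Higgs2]; journal page = PDF page + 554); pp. 592–594
[PDF 38–40] READ AS IMAGES on `run/shared/lean/pub/pub-balaban/b2b-balaban-ref1/pages/1982-cmp86-higgs23-II/
1982-cmp86-higgs23-II-p038-x2.png`, `…-p039-x2.png`, `…-p040-x2.png`, with pp. 557–559, 566 [PDF 3–5, 12] (p(ε), (2.7)–(2.8),
(2.13)–(2.15), "admissible") and part I p. 607 [PDF 5 of `1982-cmp85-higgs23-I`] ((1.19)–(1.21): blocks, large blocks = cubes
of side `ML`, `|Λ|` = number of points on the unit lattice).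

CITATION HEADER (lean-in-tree rule).  Cell `lit-balaban` (HOME `run/shared/lean/pub/lit-balaban/`), Phase-2 proof seat
**p23** gen 8 (unit `lit-balaban-p23-g8`); SKELETON rows **B2.Eq3.42** ((3.41)–(3.42) p. 592 + proviso p. 594; decl of
record `B2.Claim342Printed`) and **B2.Eq3.47** ((3.43)–(3.54) pp. 592–594; decls `B2Sect3C.Leaf347`, `Bound350`, …);
fold owner r02, second reader r14, referee ref-4.  Located gap of record: cell `pub-balaban` GAPS.md **G-pv04-3**
(items (i) SUM → SUP, (ii) COLLARS, (iii) the k = K terms and the origin of the weight `1 + log(Lᵏε)⁻¹`), which asks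
verbatim for *"a proof of `B2Sect3C.Leaf347 P ρ X A B` … from (3.42)'s left side + (3.46) + a STATED sequence-count
lemma (i) + STATED collar bounds (ii)"*.  This file is part 2 of 3 (`B2Ineq347SeqCount` → `B2Ineq347SumToSup` → `B2Ineq342From346`); it works over the
carriers of `…Balaban1983to89.B2` (`Params`, `Run`, `lhs342`) and `…Balaban1983to89.B2Sect3C` (`CData`, `epsK`, `xk`,
`rhs347`, `Leaf347`, `one_le_xk`) and uses part 1 (`sum_le_iSup_of_weights`) BY NAME; the (3.46) input is
the SHAPE proved by r14's `B2Eq341Zeta.zeta341_le` (`ζ″ ≤ 2^{#outer}·exp(−c₀p(Lᵏε)²|𝒞_k|)`, `2ⁿ = e^{n log 2}`).  Nothing of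
another seat is restated; no definition is introduced (theorems only).

WHAT IS PRINTED (p. 593 [PDF 39], verbatim).  *"From (3.41) we have  ζ″_{Λ₀⁽ᵏ⁾} ≤ Σ_{{P_v⁽ᵏ⁾,…,R_s⁽ᵏ⁾} admissible,
minimal} exp(−c₀p(Lᵏε)²|𝒞_k|) ≤ Σ_{all the subsets of Λ₀⁽ᵏ⁾ᶜ} exp(−c₀p(Lᵏε)²|𝒞_k|) = 2^{6|Λ₀⁽ᵏ⁾ᶜ|}exp(−c₀p(Lᵏε)²|𝒞_k|),
k = 0, 1, …, K − 1.  (3.46)  After easy transformations we get  (the left side of (3.42)) ≤ sup_{{Λ₀⁽⁰⁾,…,Λ⁽ᴷ⁻¹⁾}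
admissible} ·exp(−Σ_{k=0}^{K−1} c₀p(Lᵏε)²|𝒞_k|) ·exp(Σ_{k=0}^{K−1} O(1)(1 + log(Lᵏε)⁻¹)|Λ₀⁽ᵏ⁾ᶜ|) ·exp(O(1)|T₁⁽ᴷ⁾|).
(3.47)  In the second exponent we have gathered all the expressions dependent on Λ₀⁽ᵏ⁾ᶜ. The third exponent has the
required form and can be omitted in further considerations."*  The left side of (3.42) (p. 592) is the SUM
`Σ_{Λ₀⁽⁰⁾,…,Λ₀⁽ᴷ⁻¹⁾} Π_{k=0}^{K−1} ζ″_{Λ₀⁽ᵏ⁾} · exp(Σ_{k=0}^{K} O(1)(Lᵏε)^{κ₀}|Λ₇⁽ᵏ⁻¹⁾′ ∩ Λ₇⁽ᵏ⁾ᶜ|) ·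
exp(Σ_{k=0}^{K} O(1)|Λ₅⁽ᵏ⁻¹⁾′ ∩ Λ₅⁽ᵏ⁾ᶜ|)` (`B2.lhs342`); p. 566 [PDF 12]: *"The sets are unions of big blocks"*.

THE MECHANISM (continued from part 1; G-pv04-3 (ii), (iii)).  (ii) COLLARS: the factors of (3.42) carrying
`|Λ₇⁽ᵏ⁻¹⁾′ ∩ Λ₇⁽ᵏ⁾ᶜ|`, `|Λ₅⁽ᵏ⁻¹⁾′ ∩ Λ₅⁽ᵏ⁾ᶜ|` must land in the middle exponent of (3.47).  LITERALLY, (3.47) needs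
`|Λ₇…|, |Λ₅…| ≤ O(1)x_k·|Λ₀⁽ᵏ⁾ᶜ|` at every scale k < K — kept below as the explicit hypotheses `h7`/`h5` of
`leaf347_of_346` and, as G-pv04-3 (ii) records, NOT true in general for the construction (2.7)–(2.8) (a collar of width
~5r(Lᵏε) around an inherited component of `Λ₀⁽ᵏ⁾ᶜ` exceeds it by an unbounded factor); part 3 (`B2Ineq342From346`)
proves (3.42) WITHOUT (3.47) from the (3.52)-SHAPE collar bounds the corridor construction does give.  (iii) the k = K
terms of both sums of (3.42) are `≤ (C₇ + C₅)|T₁⁽ᴷ⁾|` (volumes of subsets of `T₁⁽ᴷ⁾`, `(Lᴷε)^{κ₀} ≤ 1`).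

WHAT IS KERNEL-CHECKED (zero `sorry`, no `def`; axioms standard).
 **`summand_mul_le_rhs347`** — per admissible sequence `s`: `F(s)·e^{Σ_{k<K}θx_ku_k(s)} ≤ rhs347` with `A = a₆ + θ + C₇A₇ +
    C₅A₅`, `B = C₇ + C₅`, computed with a volume majorant `Y` (`u ≤ Y.vol0c`), from the (3.46) shape
    `0 ≤ ζ″_k ≤ e^{a₆u_k}e^{−c₀p(Lᵏε)²|𝒞_k|}` (printed `a₆ = 6 log 2`, `u_k = |Λ₀⁽ᵏ⁾ᶜ|`), the collar hypotheses, `κ₀ ≥ 0`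
    and the stopping rule `Lᴷε ≤ 1`; `rhs347_mul_exp`, `rhs347_nonneg`;
 **`leaf347_of_346 : … → B2Sect3C.Leaf347 P ρ X (a₆ + θ + C₇A₇ + C₅A₅) (C₇ + C₅ + E)`** — the typed leaf (3.47)
    DERIVED from the (3.46) shape, the termwise collar absorptions, the k = K volumes and the sequence count
    `Σ_s Π_{k<K} e^{−θx_k|Λ₀⁽ᵏ⁾ᶜ|(s)} ≤ e^{E|T₁⁽ᴷ⁾|}` (discharged for large-block sequences by part 1's
    `B2Ineq347SeqCount.entropy_of_blocks`).

HONEST SCOPE.  (a) Carriers are the abstract ones of `B2`/`B2Sect3C`: this file proves IMPLICATIONS between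
printed-shape statements; the identification of `zeta`, `vol7`, `vol5`, `nC`, `vol0c` with (3.41),
`|Λ₇⁽ᵏ⁻¹⁾′∩Λ₇⁽ᵏ⁾ᶜ|`, `|Λ₅⁽ᵏ⁻¹⁾′∩Λ₅⁽ᵏ⁾ᶜ|`, `|𝒞_k|`, `|Λ₀⁽ᵏ⁾ᶜ|` of a concrete multi-scale region model is not made here.
(b) The literal (3.47) carries the termwise collar hypotheses `h7`/`h5`, which a faithful model does NOT satisfy in
general (G-pv04-3 (ii)); the result (3.42) does not need them (part 3).  (c) Value = the located unprinted step made
into a kernel-checked implication with every input named; NOT summit progress.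
-/

namespace Literature.MathematicalPhysics.QuantumFieldTheory.Balaban1983to89.B2Ineq347SumToSup

open Finset
open Literature.MathematicalPhysics.QuantumFieldTheory.Balaban1983to89
open Literature.MathematicalPhysics.QuantumFieldTheory.Balaban1983to89.B2
open Literature.MathematicalPhysics.QuantumFieldTheory.Balaban1983to89.B2Sect3C
open Literature.MathematicalPhysics.QuantumFieldTheory.Balaban1983to89.B2Ineq347SeqCount

/-! ## The per-sequence bound and the leaf (3.47) DERIVED -/

/-- `Π_{k∈s} e^{−f k} = e^{−Σ_{k∈s} f k}`. [folklore] -/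
private theorem prod_exp_neg (s : Finset ℕ) (f : ℕ → ℝ) :
    ∏ k ∈ s, Real.exp (-f k) = Real.exp (-∑ k ∈ s, f k) := by
  rw [← Finset.sum_neg_distrib, Real.exp_sum]


/-- **The per-sequence bound** (everything of (3.46) ⇒ (3.47) except the sum → sup step).  For ONE admissible sequence
`s`: the summand `F(s)` of (3.42) times the inverse weight `exp(Σ_{k<K} θx_ku_k(s))` is at most `rhs347` with
`A = a₆ + θ + C₇A₇ + C₅A₅`, `B = C₇ + C₅`, computed with the volume majorant `Y` (`u ≤ Y.vol0c`), GIVEN: the (3.46)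
shape `0 ≤ ζ″_k ≤ e^{a₆u_k}e^{−c₀p(Lᵏε)²|𝒞_k|}` (printed: `a₆ = 6 log 2`, `u_k = |Λ₀⁽ᵏ⁾ᶜ|`), the collar absorptions
`|Λ₇⁽ᵏ⁻¹⁾′∩Λ₇⁽ᵏ⁾ᶜ| ≤ A₇x_kV_k`, `|Λ₅⁽ᵏ⁻¹⁾′∩Λ₅⁽ᵏ⁾ᶜ| ≤ A₅x_kV_k` (k < K) and `≤ |T₁⁽ᴷ⁾|` (k = K), `κ₀ ≥ 0` and the
stopping rule `Lᴷε ≤ 1` (so `(Lᵏε)^{κ₀} ≤ 1`, `x_k ≥ 1`). [cite: Balaban1982Higgs2, (3.46)–(3.47) p.593] -/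
theorem summand_mul_le_rhs347 (P : Params) (ρ : Run) (Y : CData ρ) (u : ℕ → ρ.Seq → ℕ) {a₆ θ A₇ A₅ : ℝ}
    (hL : 1 ≤ (P.L : ℝ)) (hε : 0 < ρ.ε) (hK1 : epsK P ρ ρ.K ≤ 1) (hκ : 0 ≤ P.κ₀)
    (hC₇ : 0 ≤ ρ.C₇) (hC₅ : 0 ≤ ρ.C₅) (ha₆ : 0 ≤ a₆) (hθ : 0 ≤ θ) (s : ρ.Seq)
    (hz : ∀ k, k < ρ.K → 0 ≤ ρ.zeta k s)
    (h346 : ∀ k, k < ρ.K → ρ.zeta k s ≤ Real.exp (a₆ * (u k s : ℝ)) *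
        Real.exp (-(c0 P.a P.γ₀ P.d * pFn P.b₀ P.p (epsK P ρ k) ^ 2 * (Y.nC k s : ℝ))))
    (hu : ∀ k, k < ρ.K → u k s ≤ Y.vol0c k s)
    (h7 : ∀ k, k < ρ.K → (ρ.vol7 k s : ℝ) ≤ A₇ * xk P ρ k * (Y.vol0c k s : ℝ))
    (h5 : ∀ k, k < ρ.K → (ρ.vol5 k s : ℝ) ≤ A₅ * xk P ρ k * (Y.vol0c k s : ℝ))
    (h7K : ρ.vol7 ρ.K s ≤ Y.volTK) (h5K : ρ.vol5 ρ.K s ≤ Y.volTK) :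
    (∏ k ∈ range ρ.K, ρ.zeta k s)
      * Real.exp (∑ k ∈ range (ρ.K + 1), ρ.C₇ * ((P.L : ℝ) ^ k * ρ.ε) ^ P.κ₀ * (ρ.vol7 k s : ℝ))
      * Real.exp (∑ k ∈ range (ρ.K + 1), ρ.C₅ * (ρ.vol5 k s : ℝ))
      * Real.exp (∑ k ∈ range ρ.K, θ * xk P ρ k * (u k s : ℝ))
    ≤ rhs347 P ρ Y (a₆ + θ + ρ.C₇ * A₇ + ρ.C₅ * A₅) (ρ.C₇ + ρ.C₅) s := by
  -- scale facts
  have hx1 : ∀ k, k ≤ ρ.K → 1 ≤ xk P ρ k := fun k hk => one_le_xk P ρ hL hε hK1 hk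
  have hε0 : ∀ k, 0 ≤ (P.L : ℝ) ^ k * ρ.ε := fun k => by positivity
  have hε1 : ∀ k, k ≤ ρ.K → (P.L : ℝ) ^ k * ρ.ε ≤ 1 := by
    intro k hk
    refine le_trans ?_ hK1
    exact mul_le_mul_of_nonneg_right (pow_le_pow_right₀ hL hk) hε.le
  have hpow1 : ∀ k, k ≤ ρ.K → ((P.L : ℝ) ^ k * ρ.ε) ^ P.κ₀ ≤ 1 := fun k hk =>
    Real.rpow_le_one (hε0 k) (hε1 k hk) hκ
  -- Step A: the product of the ζ″ (3.46)
  have hZ : ∏ k ∈ range ρ.K, ρ.zeta k s ≤ Real.exp (∑ k ∈ range ρ.K,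
      (a₆ * (u k s : ℝ) - c0 P.a P.γ₀ P.d * pFn P.b₀ P.p (epsK P ρ k) ^ 2 * (Y.nC k s : ℝ))) := by
    calc ∏ k ∈ range ρ.K, ρ.zeta k s
        ≤ ∏ k ∈ range ρ.K, Real.exp (a₆ * (u k s : ℝ)) *
            Real.exp (-(c0 P.a P.γ₀ P.d * pFn P.b₀ P.p (epsK P ρ k) ^ 2 * (Y.nC k s : ℝ))) :=
          Finset.prod_le_prod (fun k hk => hz k (mem_range.mp hk)) fun k hk => h346 k (mem_range.mp hk)
      _ = _ := by
          rw [Real.exp_sum]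
          exact Finset.prod_congr rfl fun k _ => by rw [← Real.exp_add, sub_eq_add_neg]
  -- Step B: the Λ₇ collars
  have h7sum : ∑ k ∈ range (ρ.K + 1), ρ.C₇ * ((P.L : ℝ) ^ k * ρ.ε) ^ P.κ₀ * (ρ.vol7 k s : ℝ)
      ≤ ∑ k ∈ range ρ.K, ρ.C₇ * A₇ * xk P ρ k * (Y.vol0c k s : ℝ) + ρ.C₇ * (Y.volTK : ℝ) := by
    rw [Finset.sum_range_succ]
    apply add_le_add
    · refine Finset.sum_le_sum fun k hk => ?_
      have hk' := mem_range.mp hk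
      have hv : 0 ≤ (ρ.vol7 k s : ℝ) := Nat.cast_nonneg _
      calc ρ.C₇ * ((P.L : ℝ) ^ k * ρ.ε) ^ P.κ₀ * (ρ.vol7 k s : ℝ)
          ≤ ρ.C₇ * 1 * (A₇ * xk P ρ k * (Y.vol0c k s : ℝ)) := by
            have h1 : ρ.C₇ * ((P.L : ℝ) ^ k * ρ.ε) ^ P.κ₀ ≤ ρ.C₇ * 1 :=
              mul_le_mul_of_nonneg_left (hpow1 k hk'.le) hC₇
            exact mul_le_mul h1 (h7 k hk') hv (mul_nonneg hC₇ zero_le_one)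
        _ = ρ.C₇ * A₇ * xk P ρ k * (Y.vol0c k s : ℝ) := by ring
    · have hv : (ρ.vol7 ρ.K s : ℝ) ≤ (Y.volTK : ℝ) := by exact_mod_cast h7K
      have hv0 : 0 ≤ (ρ.vol7 ρ.K s : ℝ) := Nat.cast_nonneg _
      calc ρ.C₇ * ((P.L : ℝ) ^ ρ.K * ρ.ε) ^ P.κ₀ * (ρ.vol7 ρ.K s : ℝ) ≤ ρ.C₇ * 1 * (Y.volTK : ℝ) := by
            have h1 : ρ.C₇ * ((P.L : ℝ) ^ ρ.K * ρ.ε) ^ P.κ₀ ≤ ρ.C₇ * 1 :=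
              mul_le_mul_of_nonneg_left (hpow1 ρ.K le_rfl) hC₇
            exact mul_le_mul h1 hv hv0 (mul_nonneg hC₇ zero_le_one)
        _ = ρ.C₇ * (Y.volTK : ℝ) := by ring
  -- Step C: the Λ₅ collars
  have h5sum : ∑ k ∈ range (ρ.K + 1), ρ.C₅ * (ρ.vol5 k s : ℝ)
      ≤ ∑ k ∈ range ρ.K, ρ.C₅ * A₅ * xk P ρ k * (Y.vol0c k s : ℝ) + ρ.C₅ * (Y.volTK : ℝ) := by
    rw [Finset.sum_range_succ]
    apply add_le_add
    · refine Finset.sum_le_sum fun k hk => ?_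
      have hk' := mem_range.mp hk
      calc ρ.C₅ * (ρ.vol5 k s : ℝ) ≤ ρ.C₅ * (A₅ * xk P ρ k * (Y.vol0c k s : ℝ)) :=
            mul_le_mul_of_nonneg_left (h5 k hk') hC₅
        _ = ρ.C₅ * A₅ * xk P ρ k * (Y.vol0c k s : ℝ) := by ring
    · have hv : (ρ.vol5 ρ.K s : ℝ) ≤ (Y.volTK : ℝ) := by exact_mod_cast h5K
      exact mul_le_mul_of_nonneg_left hv hC₅
  -- Step D: the ζ″ entropy `a₆u` and the inverse weight `θx_ku` against the majorant volume
  have hDsum : ∑ k ∈ range ρ.K, (a₆ * (u k s : ℝ) + θ * xk P ρ k * (u k s : ℝ))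
      ≤ ∑ k ∈ range ρ.K, (a₆ * xk P ρ k * (Y.vol0c k s : ℝ) + θ * xk P ρ k * (Y.vol0c k s : ℝ)) := by
    refine Finset.sum_le_sum fun k hk => ?_
    have hk' := mem_range.mp hk
    have hx := hx1 k hk'.le
    have huv : (u k s : ℝ) ≤ (Y.vol0c k s : ℝ) := by exact_mod_cast hu k hk'
    have hV0 : 0 ≤ (Y.vol0c k s : ℝ) := Nat.cast_nonneg _
    have e1 : a₆ * (u k s : ℝ) ≤ a₆ * xk P ρ k * (Y.vol0c k s : ℝ) := by
      calc a₆ * (u k s : ℝ) ≤ a₆ * (Y.vol0c k s : ℝ) := mul_le_mul_of_nonneg_left huv ha₆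
        _ = a₆ * 1 * (Y.vol0c k s : ℝ) := by ring
        _ ≤ a₆ * xk P ρ k * (Y.vol0c k s : ℝ) :=
            mul_le_mul_of_nonneg_right (mul_le_mul_of_nonneg_left hx ha₆) hV0
    have e2 : θ * xk P ρ k * (u k s : ℝ) ≤ θ * xk P ρ k * (Y.vol0c k s : ℝ) :=
      mul_le_mul_of_nonneg_left huv (mul_nonneg hθ (le_trans zero_le_one hx))
    linarith
  -- Step E: assemble
  have hA : ∑ k ∈ range ρ.K, (a₆ + θ + ρ.C₇ * A₇ + ρ.C₅ * A₅) * xk P ρ k * (Y.vol0c k s : ℝ)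
      = ∑ k ∈ range ρ.K, (a₆ * xk P ρ k * (Y.vol0c k s : ℝ) + θ * xk P ρ k * (Y.vol0c k s : ℝ))
        + ∑ k ∈ range ρ.K, ρ.C₇ * A₇ * xk P ρ k * (Y.vol0c k s : ℝ)
        + ∑ k ∈ range ρ.K, ρ.C₅ * A₅ * xk P ρ k * (Y.vol0c k s : ℝ) := by
    rw [← Finset.sum_add_distrib, ← Finset.sum_add_distrib]
    exact Finset.sum_congr rfl fun k _ => by ring
  have hsplit : ∑ k ∈ range ρ.K,
        (a₆ * (u k s : ℝ) - c0 P.a P.γ₀ P.d * pFn P.b₀ P.p (epsK P ρ k) ^ 2 * (Y.nC k s : ℝ))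
      = ∑ k ∈ range ρ.K, (a₆ * (u k s : ℝ) + θ * xk P ρ k * (u k s : ℝ))
        - ∑ k ∈ range ρ.K, c0 P.a P.γ₀ P.d * pFn P.b₀ P.p (epsK P ρ k) ^ 2 * (Y.nC k s : ℝ)
        - ∑ k ∈ range ρ.K, θ * xk P ρ k * (u k s : ℝ) := by
    rw [← Finset.sum_sub_distrib, ← Finset.sum_sub_distrib]
    exact Finset.sum_congr rfl fun k _ => by ring
  have hrhs : rhs347 P ρ Y (a₆ + θ + ρ.C₇ * A₇ + ρ.C₅ * A₅) (ρ.C₇ + ρ.C₅) s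
      = Real.exp (-(∑ k ∈ range ρ.K, c0 P.a P.γ₀ P.d * pFn P.b₀ P.p (epsK P ρ k) ^ 2 * (Y.nC k s : ℝ))
          + ∑ k ∈ range ρ.K, (a₆ + θ + ρ.C₇ * A₇ + ρ.C₅ * A₅) * xk P ρ k * (Y.vol0c k s : ℝ)
          + (ρ.C₇ + ρ.C₅) * (Y.volTK : ℝ)) := by
    unfold rhs347
    rw [← Real.exp_add, ← Real.exp_add]
  rw [hrhs]
  calc (∏ k ∈ range ρ.K, ρ.zeta k s)
        * Real.exp (∑ k ∈ range (ρ.K + 1), ρ.C₇ * ((P.L : ℝ) ^ k * ρ.ε) ^ P.κ₀ * (ρ.vol7 k s : ℝ))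
        * Real.exp (∑ k ∈ range (ρ.K + 1), ρ.C₅ * (ρ.vol5 k s : ℝ))
        * Real.exp (∑ k ∈ range ρ.K, θ * xk P ρ k * (u k s : ℝ))
      ≤ Real.exp (∑ k ∈ range ρ.K,
            (a₆ * (u k s : ℝ) - c0 P.a P.γ₀ P.d * pFn P.b₀ P.p (epsK P ρ k) ^ 2 * (Y.nC k s : ℝ)))
        * Real.exp (∑ k ∈ range (ρ.K + 1), ρ.C₇ * ((P.L : ℝ) ^ k * ρ.ε) ^ P.κ₀ * (ρ.vol7 k s : ℝ))
        * Real.exp (∑ k ∈ range (ρ.K + 1), ρ.C₅ * (ρ.vol5 k s : ℝ))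
        * Real.exp (∑ k ∈ range ρ.K, θ * xk P ρ k * (u k s : ℝ)) := by
          have e0 := (Real.exp_pos (∑ k ∈ range (ρ.K + 1),
            ρ.C₇ * ((P.L : ℝ) ^ k * ρ.ε) ^ P.κ₀ * (ρ.vol7 k s : ℝ))).le
          exact mul_le_mul_of_nonneg_right (mul_le_mul_of_nonneg_right
            (mul_le_mul_of_nonneg_right hZ e0) (Real.exp_pos _).le) (Real.exp_pos _).le
    _ = Real.exp (∑ k ∈ range ρ.K,
            (a₆ * (u k s : ℝ) - c0 P.a P.γ₀ P.d * pFn P.b₀ P.p (epsK P ρ k) ^ 2 * (Y.nC k s : ℝ))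
          + ∑ k ∈ range (ρ.K + 1), ρ.C₇ * ((P.L : ℝ) ^ k * ρ.ε) ^ P.κ₀ * (ρ.vol7 k s : ℝ)
          + ∑ k ∈ range (ρ.K + 1), ρ.C₅ * (ρ.vol5 k s : ℝ)
          + ∑ k ∈ range ρ.K, θ * xk P ρ k * (u k s : ℝ)) := by
          rw [← Real.exp_add, ← Real.exp_add, ← Real.exp_add]
    _ ≤ _ := by
          apply Real.exp_le_exp.mpr
          rw [hsplit, hA]
          linarith [h7sum, h5sum, hDsum]

/-- `rhs347` with a larger third O(1): `rhs347 A B s · e^{E|T₁⁽ᴷ⁾|} = rhs347 A (B + E) s`.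
(Folklore: `Real.exp_add`.) [cite: Balaban1982Higgs2, (3.47) p.593] -/
theorem rhs347_mul_exp (P : Params) (ρ : Run) (X : CData ρ) (A B E : ℝ) (s : ρ.Seq) :
    rhs347 P ρ X A B s * Real.exp (E * (X.volTK : ℝ)) = rhs347 P ρ X A (B + E) s := by
  unfold rhs347
  rw [add_mul, Real.exp_add]
  ring

/-- `rhs347 ≥ 0`. [cite: Balaban1982Higgs2, (3.47) p.593] -/
theorem rhs347_nonneg (P : Params) (ρ : Run) (X : CData ρ) (A B : ℝ) (s : ρ.Seq) : 0 ≤ rhs347 P ρ X A B s := by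
  unfold rhs347
  positivity

/-- **LEAF (3.47) DERIVED** — *"After easy transformations we get (the left side of (3.42)) ≤ sup_{admissible} …
(3.47)"* as a THEOREM: `B2Sect3C.Leaf347 P ρ X (a₆ + θ + C₇A₇ + C₅A₅) (C₇ + C₅ + E)` for every run whose data satisfy,
at every admissible sequence, the (3.46) shape `0 ≤ ζ″_k ≤ e^{a₆|Λ₀⁽ᵏ⁾ᶜ|}e^{−c₀p(Lᵏε)²|𝒞_k|}` (printed `a₆ = 6 log 2`),
the TERMWISE collar absorptions `|Λ₇⁽ᵏ⁻¹⁾′∩Λ₇⁽ᵏ⁾ᶜ| ≤ A₇(1 + log(Lᵏε)⁻¹)|Λ₀⁽ᵏ⁾ᶜ|`, `|Λ₅⁽ᵏ⁻¹⁾′∩Λ₅⁽ᵏ⁾ᶜ| ≤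
A₅(1 + log(Lᵏε)⁻¹)|Λ₀⁽ᵏ⁾ᶜ|` (k < K; *"In the second exponent we have gathered all the expressions dependent on
Λ₀⁽ᵏ⁾ᶜ"* — what the printed middle factor literally requires; NOT true in general for the construction (2.7)–(2.8),
cell GAPS G-pv04-3 (ii): see `B2Ineq342From346.ineq342_of_346` for the route that does not need it), the k = K volumes `≤ |T₁⁽ᴷ⁾|`, and
the SEQUENCE COUNT `Σ_s Π_{k<K} e^{−θ(1+log(Lᵏε)⁻¹)|Λ₀⁽ᵏ⁾ᶜ|(s)} ≤ e^{E|T₁⁽ᴷ⁾|}` (discharged for large-block sequences by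
`B2Ineq347SeqCount.entropy_of_blocks`), under `κ₀ ≥ 0`, `C₇, C₅ ≥ 0` and the stopping rule `Lᴷε ≤ 1`.
[cite: Balaban1982Higgs2, (3.47) p.593] -/
theorem leaf347_of_346 (P : Params) (ρ : Run) (X : CData ρ) {a₆ θ A₇ A₅ E : ℝ}
    (hL : 1 ≤ (P.L : ℝ)) (hε : 0 < ρ.ε) (hK1 : epsK P ρ ρ.K ≤ 1) (hκ : 0 ≤ P.κ₀)
    (hC₇ : 0 ≤ ρ.C₇) (hC₅ : 0 ≤ ρ.C₅) (ha₆ : 0 ≤ a₆) (hθ : 0 ≤ θ)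
    (hz : ∀ s k, k < ρ.K → 0 ≤ ρ.zeta k s)
    (h346 : ∀ s k, k < ρ.K → ρ.zeta k s ≤ Real.exp (a₆ * (X.vol0c k s : ℝ)) *
        Real.exp (-(c0 P.a P.γ₀ P.d * pFn P.b₀ P.p (epsK P ρ k) ^ 2 * (X.nC k s : ℝ))))
    (h7 : ∀ s k, k < ρ.K → (ρ.vol7 k s : ℝ) ≤ A₇ * xk P ρ k * (X.vol0c k s : ℝ))
    (h5 : ∀ s k, k < ρ.K → (ρ.vol5 k s : ℝ) ≤ A₅ * xk P ρ k * (X.vol0c k s : ℝ))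
    (h7K : ∀ s, ρ.vol7 ρ.K s ≤ X.volTK) (h5K : ∀ s, ρ.vol5 ρ.K s ≤ X.volTK)
    (hent : (letI := ρ.fin; ∑ s : ρ.Seq, ∏ k ∈ range ρ.K, Real.exp (-(θ * xk P ρ k * (X.vol0c k s : ℝ))))
        ≤ Real.exp (E * (X.volTK : ℝ))) :
    Leaf347 P ρ X (a₆ + θ + ρ.C₇ * A₇ + ρ.C₅ * A₅) (ρ.C₇ + ρ.C₅ + E) := by
  letI := ρ.fin
  -- the weight sum (sequence count)
  have hw : ∑ t : ρ.Seq, Real.exp (-(∑ k ∈ range ρ.K, θ * xk P ρ k * (X.vol0c k t : ℝ)))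
      ≤ Real.exp (E * (X.volTK : ℝ)) := by
    refine le_trans (le_of_eq (Finset.sum_congr rfl fun t _ => ?_)) hent
    rw [← prod_exp_neg]
  -- per sequence: `F(s)·Σ_t w(t) ≤ rhs347(s)·w(s)`
  have key : ∀ s : ρ.Seq,
      (∏ k ∈ range ρ.K, ρ.zeta k s)
        * Real.exp (∑ k ∈ range (ρ.K + 1), ρ.C₇ * ((P.L : ℝ) ^ k * ρ.ε) ^ P.κ₀ * (ρ.vol7 k s : ℝ))
        * Real.exp (∑ k ∈ range (ρ.K + 1), ρ.C₅ * (ρ.vol5 k s : ℝ))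
        * ∑ t : ρ.Seq, Real.exp (-(∑ k ∈ range ρ.K, θ * xk P ρ k * (X.vol0c k t : ℝ)))
      ≤ rhs347 P ρ X (a₆ + θ + ρ.C₇ * A₇ + ρ.C₅ * A₅) (ρ.C₇ + ρ.C₅ + E) s
        * Real.exp (-(∑ k ∈ range ρ.K, θ * xk P ρ k * (X.vol0c k s : ℝ))) := by
    intro s
    have hs := summand_mul_le_rhs347 P ρ X X.vol0c hL hε hK1 hκ hC₇ hC₅ ha₆ hθ s (hz s) (h346 s)
      (fun k _ => le_rfl) (h7 s) (h5 s) (h7K s) (h5K s)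
    set F : ℝ := (∏ k ∈ range ρ.K, ρ.zeta k s)
        * Real.exp (∑ k ∈ range (ρ.K + 1), ρ.C₇ * ((P.L : ℝ) ^ k * ρ.ε) ^ P.κ₀ * (ρ.vol7 k s : ℝ))
        * Real.exp (∑ k ∈ range (ρ.K + 1), ρ.C₅ * (ρ.vol5 k s : ℝ))
    set Sθ : ℝ := ∑ k ∈ range ρ.K, θ * xk P ρ k * (X.vol0c k s : ℝ)
    have hFw : F ≤ rhs347 P ρ X (a₆ + θ + ρ.C₇ * A₇ + ρ.C₅ * A₅) (ρ.C₇ + ρ.C₅) s * Real.exp (-Sθ) := by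
      have e : F = F * Real.exp Sθ * Real.exp (-Sθ) := by
        rw [mul_assoc, ← Real.exp_add, add_neg_cancel, Real.exp_zero, mul_one]
      rw [e]
      exact mul_le_mul_of_nonneg_right hs (Real.exp_pos _).le
    have hR0 := rhs347_nonneg P ρ X (a₆ + θ + ρ.C₇ * A₇ + ρ.C₅ * A₅) (ρ.C₇ + ρ.C₅) s
    calc F * ∑ t : ρ.Seq, Real.exp (-(∑ k ∈ range ρ.K, θ * xk P ρ k * (X.vol0c k t : ℝ)))
        ≤ (rhs347 P ρ X (a₆ + θ + ρ.C₇ * A₇ + ρ.C₅ * A₅) (ρ.C₇ + ρ.C₅) s * Real.exp (-Sθ))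
            * Real.exp (E * (X.volTK : ℝ)) :=
          mul_le_mul hFw hw (Finset.sum_nonneg fun t _ => (Real.exp_pos _).le)
            (mul_nonneg hR0 (Real.exp_pos _).le)
      _ = rhs347 P ρ X (a₆ + θ + ρ.C₇ * A₇ + ρ.C₅ * A₅) (ρ.C₇ + ρ.C₅ + E) s * Real.exp (-Sθ) := by
          rw [mul_right_comm, rhs347_mul_exp]
  unfold Leaf347 lhs342
  exact sum_le_iSup_of_weights
    (fun s => (∏ k ∈ range ρ.K, ρ.zeta k s)
      * Real.exp (∑ k ∈ range (ρ.K + 1), ρ.C₇ * ((P.L : ℝ) ^ k * ρ.ε) ^ P.κ₀ * (ρ.vol7 k s : ℝ))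
      * Real.exp (∑ k ∈ range (ρ.K + 1), ρ.C₅ * (ρ.vol5 k s : ℝ)))
    (fun s => Real.exp (-(∑ k ∈ range ρ.K, θ * xk P ρ k * (X.vol0c k s : ℝ))))
    (fun s => rhs347 P ρ X (a₆ + θ + ρ.C₇ * A₇ + ρ.C₅ * A₅) (ρ.C₇ + ρ.C₅ + E) s)
    (fun s => Real.exp_pos _) key

end Literature.MathematicalPhysics.QuantumFieldTheory.Balaban1983to89.B2Ineq347SumToSup
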